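import Mathlib
import HarnessLib

/-!
# The method of approximation (Davis–Rabinowitz 1984, Sect. 2.5.8)

**Source.** P. J. Davis, P. Rabinowitz, *Methods of Numerical Integration* (2nd ed., Academic Press, 1984),
Sect. 2.5.8 "The Method of Approximation", (2.5.8.1)–(2.5.8.4) and Examples 1–3.

**Statement.** Approximate the integrand by functions that can be integrated in closed form,
`f(x) = a₁φ₁(x) + ⋯ + aₙφₙ(x) + εₙ(x)` (2.5.8.1) with `εₙ` small on the range of integration; the integral of
the approximation approximates the integral.
* Example 1 (Bernstein polynomials): `Bₙ(f; x) = Σ_{k=0}^{n} C(n,k) f(k/n) xᵏ(1−x)^{n−k}` (2.5.8.2),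
  `Bₙ(f; x) → f(x)` uniformly on `[0, 1]`, and `∫₀¹ Bₙ(f; x) dx = (1/(n+1)) Σ_{k=0}^{n} f(k/n)`: integrating the
  Bernstein approximation is averaging `f` at the equidistant stations `0, 1/n, …, n/n`.
* Example 2 (Taylor polynomials): for `f(z) = f(0) + f'(0)z + ⋯ + f⁽ⁿ⁾(0)zⁿ/n! + εₙ(z)` (2.5.8.3),
  `½ ∫_{−1}^{1} f(x) dx ≈ f(0) + f''(0)/3! + f⁽⁴⁾(0)/5! + ⋯ + f^{(2m)}(0)/(2m+1)!`, `m = [n/2]` (2.5.8.4).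
* Best approximation: if `max_{a ≤ x ≤ b} |f(x) − p(x)| = δ`, the integral of `p` is good to within `(b − a)δ`.
* Example 3: `I = ∫₀¹ x^{1/2} Γ(x+2) dx` with `Γ(x+2) = .99910836 + .4497361x + .2855737x² + .2646888x³ + ε(x)`,
  `|ε| ≤ .0009` on `[0, 1]`, gives `I = (2/3)(.99910836) + (2/5)(.4497361) + (2/7)(.2855737) + (2/9)(.2646888) + η`,
  `|η| ≤ (2/3)(.0009) = .0006`, `I ≈ .986`.

**What is typed** (all PROVED, Mathlib only):
* `integral_bernsteinPolynomial`: `∫₀¹ C(n,k) xᵏ(1−x)^{n−k} dx = 1/(n+1)` for `k ≤ n` (via Mathlib's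
  `bernsteinPolynomial.derivative_succ` and the fundamental theorem of calculus);
* `bernsteinSum n f x = Σ_{k ≤ n} f(k/n) · bₙ,ₖ(x)` (2.5.8.2), its identification with Mathlib's
  `bernsteinApproximation` on `[0,1]`, `∫₀¹ Bₙ(f; ·) = (Σ f(k/n))/(n+1)` (`integral_bernsteinSum`), and the
  convergence of these averages to `∫₀¹ f` for `f` continuous on `[0, 1]` (`tendsto_bernstein_average`);
* (2.5.8.4) for polynomial (Taylor) data: `½ ∫_{−1}^{1} p = Σ_{j even} p_j/(j+1)` (`half_integral_eq_sum_even_coeff`);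
* the best-approximation bounds `|∫_a^b f − ∫_a^b p| ≤ (b − a)δ` and the weighted form `≤ δ ∫ w` for `w ≥ 0`;
* Example 3: the moments `∫₀¹ x^{1/2} xᵏ dx = 2/(2k+3)`, the value of the approximate integral and the bound
  `|η| ≤ .0006` under the HYPOTHESIS `|Γ(x+2) − cubic| ≤ .0009` (the Hart et al. approximation itself is not
  certified here), and `.9863 < I_approx < .9864`.

References: [cite: DavisRabinowitz1984, Sect. 2.5.8 (2.5.8.1)-(2.5.8.4)].
-/

namespace Literature.Analysis.Quadrature

open Real Finset Filter Topology MeasureTheory intervalIntegral Polynomial unitInterval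
open scoped Interval

/-! ## Example 1: Bernstein polynomials (2.5.8.2) -/

/-- The Bernstein basis polynomial evaluates to `C(n,k) xᵏ (1−x)^{n−k}`.
[cite: DavisRabinowitz1984, Sect. 2.5.8 (2.5.8.2)] -/
theorem bernsteinPolynomial_eval (n k : ℕ) (x : ℝ) :
    (bernsteinPolynomial ℝ n k).eval x = (n.choose k : ℝ) * x ^ k * (1 - x) ^ (n - k) := by
  simp [bernsteinPolynomial, Polynomial.eval_mul, Polynomial.eval_pow]

/-- The integral of a polynomial derivative over `[0, 1]`. [folklore] -/
private theorem integral_derivative_eval_unit (p : ℝ[X]) :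
    ∫ x in (0:ℝ)..1, p.derivative.eval x = p.eval 1 - p.eval 0 := by
  rw [intervalIntegral.integral_eq_sub_of_hasDerivAt (fun x _ => p.hasDerivAt x)
    (p.derivative.continuous.intervalIntegrable _ _)]

/-- One step of the recursion: `(n+1) (∫₀¹ bₙ,ₖ − ∫₀¹ bₙ,ₖ₊₁) = bₙ₊₁,ₖ₊₁(1) − bₙ₊₁,ₖ₊₁(0) = [k = n]`.
[cite: DavisRabinowitz1984, Sect. 2.5.8 (2.5.8.2)] -/
theorem integral_bernsteinPolynomial_step (n k : ℕ) :
    ((n:ℝ) + 1) * ((∫ x in (0:ℝ)..1, (bernsteinPolynomial ℝ n k).eval x)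
      - ∫ x in (0:ℝ)..1, (bernsteinPolynomial ℝ n (k + 1)).eval x) = if k = n then 1 else 0 := by
  have hd := bernsteinPolynomial.derivative_succ (R := ℝ) (n + 1) k
  simp only [Nat.add_sub_cancel, Nat.cast_add, Nat.cast_one] at hd
  have hint := integral_derivative_eval_unit (bernsteinPolynomial ℝ (n + 1) (k + 1))
  rw [hd] at hint
  rw [bernsteinPolynomial.eval_at_1, bernsteinPolynomial.eval_at_0, if_neg (Nat.succ_ne_zero k),
    sub_zero] at hint
  simp only [Nat.add_right_cancel_iff] at hint
  rw [← hint]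
  have h1 : IntervalIntegrable (fun x => (bernsteinPolynomial ℝ n k).eval x) volume (0:ℝ) 1 :=
    (Polynomial.continuous _).intervalIntegrable _ _
  have h2 : IntervalIntegrable (fun x => (bernsteinPolynomial ℝ n (k + 1)).eval x) volume (0:ℝ) 1 :=
    (Polynomial.continuous _).intervalIntegrable _ _
  rw [← intervalIntegral.integral_sub h1 h2, ← intervalIntegral.integral_const_mul]
  refine intervalIntegral.integral_congr fun x _ => ?_
  simp only [Polynomial.eval_mul, Polynomial.eval_sub, Polynomial.eval_add, Polynomial.eval_natCast,
    Polynomial.eval_one]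

/-- **Integral of a Bernstein basis polynomial**: `∫₀¹ C(n,k) xᵏ(1−x)^{n−k} dx = 1/(n+1)` for every
`k ≤ n` (the inner integral of (2.5.8.2)). [cite: DavisRabinowitz1984, Sect. 2.5.8 (2.5.8.2)] -/
theorem integral_bernsteinPolynomial {n k : ℕ} (hk : k ≤ n) :
    ∫ x in (0:ℝ)..1, (bernsteinPolynomial ℝ n k).eval x = 1 / ((n:ℝ) + 1) := by
  -- downward induction on `n - k`
  obtain ⟨j, rfl⟩ : ∃ j, n = k + j := ⟨n - k, by omega⟩
  clear hk
  induction j generalizing k with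
  | zero =>
    have h := integral_bernsteinPolynomial_step k k
    rw [if_pos rfl, bernsteinPolynomial.eq_zero_of_lt ℝ (by omega : k < k + 1)] at h
    simp only [Polynomial.eval_zero, intervalIntegral.integral_zero, sub_zero] at h
    simp only [Nat.add_zero]
    have hne : ((k:ℝ) + 1) ≠ 0 := by positivity
    rw [eq_div_iff hne, mul_comm]
    exact h
  | succ j ih =>
    have h := integral_bernsteinPolynomial_step (k + (j + 1)) k
    rw [if_neg (by omega)] at h
    have ih' := ih (k := k + 1)
    rw [show k + 1 + j = k + (j + 1) by ring] at ih'
    have hne : (((k + (j + 1) : ℕ) : ℝ) + 1) ≠ 0 := by positivity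
    rcases mul_eq_zero.mp h with h0 | h0
    · exact absurd h0 hne
    · rw [sub_eq_zero] at h0
      rw [h0, ih']

/-- The Bernstein polynomial `Bₙ(f; x) = Σ_{k=0}^{n} C(n,k) f(k/n) xᵏ(1−x)^{n−k}` of (2.5.8.2), for a real
function `f` sampled at the stations `k/n`. [cite: DavisRabinowitz1984, Sect. 2.5.8 (2.5.8.2)] -/
noncomputable def bernsteinSum (n : ℕ) (f : ℝ → ℝ) (x : ℝ) : ℝ :=
  ∑ k ∈ Finset.range (n + 1), f (k / n) * (bernsteinPolynomial ℝ n k).eval x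

/-- `Bₙ(f; ·)` is continuous (a polynomial). [cite: DavisRabinowitz1984, Sect. 2.5.8 (2.5.8.2)] -/
theorem continuous_bernsteinSum (n : ℕ) (f : ℝ → ℝ) : Continuous (bernsteinSum n f) := by
  unfold bernsteinSum
  exact continuous_finsetSum _ fun k _ => continuous_const.mul (Polynomial.continuous _)

/-- **(2.5.8.2), integrated**: `∫₀¹ Bₙ(f; x) dx = (1/(n+1)) Σ_{k=0}^{n} f(k/n)` — integrating the Bernstein
approximation is averaging `f` at the equidistant stations `0, 1/n, …, n/n`.
[cite: DavisRabinowitz1984, Sect. 2.5.8 (2.5.8.2)] -/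
theorem integral_bernsteinSum (n : ℕ) (f : ℝ → ℝ) :
    ∫ x in (0:ℝ)..1, bernsteinSum n f x = (∑ k ∈ Finset.range (n + 1), f (k / n)) / ((n:ℝ) + 1) := by
  unfold bernsteinSum
  have hi : ∀ k ∈ Finset.range (n + 1), IntervalIntegrable
      (fun x => f (k / n) * (bernsteinPolynomial ℝ n k).eval x) volume (0:ℝ) 1 := fun k _ =>
    ((continuous_const.mul (Polynomial.continuous _) :
      Continuous fun x => f (k / n) * (bernsteinPolynomial ℝ n k).eval x)).intervalIntegrable _ _
  rw [intervalIntegral.integral_finsetSum hi, Finset.sum_div]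
  refine Finset.sum_congr rfl fun k hk => ?_
  rw [intervalIntegral.integral_const_mul, integral_bernsteinPolynomial (by simpa [Nat.lt_succ_iff] using hk)]
  ring

/-- On `[0, 1]`, `Bₙ(f; x)` is Mathlib's `bernsteinApproximation n F x` for the restriction `F` of `f` to the
unit interval. [cite: DavisRabinowitz1984, Sect. 2.5.8 (2.5.8.2)] -/
theorem bernsteinSum_eq_bernsteinApproximation (n : ℕ) {f : ℝ → ℝ} (hf : ContinuousOn f I) (x : I) :
    bernsteinSum n f x = bernsteinApproximation n (⟨Set.restrict I f, hf.restrict⟩ : C(I, ℝ)) x := by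
  rw [bernsteinApproximation.apply, bernsteinSum, Finset.sum_range]
  refine Finset.sum_congr rfl fun k _ => ?_
  rw [bernstein_apply, bernsteinPolynomial_eval, smul_eq_mul, mul_comm]
  rfl

/-- Uniform control on `[0, 1]`: `|Bₙ(f; x) − f(x)| ≤ ‖bernsteinApproximation n F − F‖`.
[cite: DavisRabinowitz1984, Sect. 2.5.8 (2.5.8.2)] -/
theorem abs_bernsteinSum_sub_le (n : ℕ) {f : ℝ → ℝ} (hf : ContinuousOn f I) {x : ℝ} (hx : x ∈ I) :
    |bernsteinSum n f x - f x|
      ≤ ‖bernsteinApproximation n (⟨Set.restrict I f, hf.restrict⟩ : C(I, ℝ)) - (⟨Set.restrict I f, hf.restrict⟩ : C(I, ℝ))‖ := by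
  have h := ContinuousMap.norm_coe_le_norm
    (bernsteinApproximation n (⟨Set.restrict I f, hf.restrict⟩ : C(I, ℝ)) - (⟨Set.restrict I f, hf.restrict⟩ : C(I, ℝ))) ⟨x, hx⟩
  rw [ContinuousMap.sub_apply, ← bernsteinSum_eq_bernsteinApproximation n hf ⟨x, hx⟩] at h
  simpa using h

/-- **`∫₀¹ f ≈ ∫₀¹ Bₙ(f; ·) = (1/(n+1)) Σ f(k/n)`**: since `Bₙ(f; x) → f(x)` uniformly on `[0, 1]`
(Mathlib's `bernsteinApproximation_uniform`), the averages at the equidistant stations converge to the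
integral of the continuous function `f`. [cite: DavisRabinowitz1984, Sect. 2.5.8 (2.5.8.2)] -/
theorem tendsto_bernstein_average {f : ℝ → ℝ} (hf : ContinuousOn f I) :
    Tendsto (fun n : ℕ => (∑ k ∈ Finset.range (n + 1), f (k / n)) / ((n:ℝ) + 1)) atTop
      (𝓝 (∫ x in (0:ℝ)..1, f x)) := by
  set F : C(I, ℝ) := (⟨Set.restrict I f, hf.restrict⟩ : C(I, ℝ)) with hF
  have hu : Tendsto (fun n : ℕ => ‖bernsteinApproximation n F - F‖) atTop (𝓝 0) := by
    have := bernsteinApproximation_uniform F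
    rwa [tendsto_iff_norm_sub_tendsto_zero] at this
  have hfi : IntervalIntegrable f volume (0:ℝ) 1 :=
    (hf.mono (by simp)).intervalIntegrable
  rw [tendsto_iff_norm_sub_tendsto_zero]
  refine squeeze_zero (fun n => norm_nonneg _) (fun n => ?_) hu
  rw [← integral_bernsteinSum, ← intervalIntegral.integral_sub
    ((continuous_bernsteinSum n f).intervalIntegrable _ _) hfi, Real.norm_eq_abs]
  have hb : ∀ x ∈ Ι (0:ℝ) 1, ‖bernsteinSum n f x - f x‖ ≤ ‖bernsteinApproximation n F - F‖ := by
    intro x hx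
    rw [Real.norm_eq_abs]
    have hx' : x ∈ I := by
      rw [Set.uIoc_of_le zero_le_one] at hx
      exact ⟨hx.1.le, hx.2⟩
    exact abs_bernsteinSum_sub_le n hf hx'
  have := intervalIntegral.norm_integral_le_of_norm_le_const hb
  simpa using this

/-! ## Example 2: Taylor polynomials (2.5.8.3)–(2.5.8.4) -/

/-- Moments of the symmetric interval: `∫_{−1}^{1} xʲ dx = (1 + (−1)ʲ)/(j+1)` (`2/(j+1)` for even `j`, `0` for
odd `j`). [cite: DavisRabinowitz1984, Sect. 2.5.8 (2.5.8.4)] -/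
theorem integral_pow_symm (j : ℕ) :
    ∫ x in (-1:ℝ)..1, x ^ j = (1 + (-1:ℝ) ^ j) / (j + 1) := by
  rw [integral_pow]
  rw [show ((-1:ℝ)) ^ (j + 1) = -((-1:ℝ) ^ j) by ring]
  ring

/-- **(2.5.8.4)** for the Taylor polynomial itself: if `p(x) = Σ_{j ≤ n} cⱼ xʲ` (`cⱼ = f⁽ʲ⁾(0)/j!`), then
`½ ∫_{−1}^{1} p(x) dx = Σ_{j ≤ n, j even} cⱼ/(j+1) = c₀ + c₂/3 + c₄/5 + ⋯`
(`f''(0)/3! = c₂/3`, `f⁽⁴⁾(0)/5! = c₄/5`, …). [cite: DavisRabinowitz1984, Sect. 2.5.8 (2.5.8.3)-(2.5.8.4)] -/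
theorem half_integral_taylor_sum (n : ℕ) (c : ℕ → ℝ) :
    (1/2 : ℝ) * ∫ x in (-1:ℝ)..1, ∑ j ∈ Finset.range (n + 1), c j * x ^ j
      = ∑ j ∈ Finset.range (n + 1), if Even j then c j / (j + 1) else 0 := by
  have hi : ∀ j ∈ Finset.range (n + 1),
      IntervalIntegrable (fun x : ℝ => c j * x ^ j) volume (-1:ℝ) 1 := fun j _ =>
    ((continuous_const.mul (continuous_pow j) : Continuous fun x : ℝ => c j * x ^ j)).intervalIntegrable _ _
  rw [intervalIntegral.integral_finsetSum hi, Finset.mul_sum]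
  refine Finset.sum_congr rfl fun j _ => ?_
  rw [intervalIntegral.integral_const_mul, integral_pow_symm]
  rcases Nat.even_or_odd j with hj | hj
  · rw [if_pos hj, hj.neg_one_pow]; field_simp; ring
  · rw [if_neg (Nat.not_even_iff_odd.2 hj), hj.neg_one_pow]; ring

/-- The Taylor coefficients `f⁽ʲ⁾(0)/j!` of (2.5.8.3) in the even slots give the terms
`f^{(2m)}(0)/(2m+1)!` of (2.5.8.4): `(a/(2m)!)/(2m+1) = a/(2m+1)!`.
[cite: DavisRabinowitz1984, Sect. 2.5.8 (2.5.8.4)] -/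
theorem taylor_coeff_div (a : ℝ) (m : ℕ) :
    a / ((2 * m).factorial : ℝ) / (((2 * m : ℕ) : ℝ) + 1) = a / ((2 * m + 1).factorial : ℝ) := by
  rw [Nat.factorial_succ, Nat.cast_mul, div_div]
  congr 1
  push_cast
  ring

/-! ## Best approximations: the `(b − a)δ` bound -/

/-- If `|f(x) − p(x)| ≤ δ` on `[a, b]`, the integral of the approximation is good to within `(b − a)δ`:
`|∫_a^b f − ∫_a^b p| ≤ (b − a)δ`. [cite: DavisRabinowitz1984, Sect. 2.5.8 (2.5.8.1)] -/
theorem abs_integral_sub_integral_le_of_approx {a b δ : ℝ} (hab : a ≤ b) {f p : ℝ → ℝ}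
    (hf : IntervalIntegrable f volume a b) (hp : IntervalIntegrable p volume a b)
    (h : ∀ x ∈ Set.Icc a b, |f x - p x| ≤ δ) :
    |(∫ x in a..b, f x) - ∫ x in a..b, p x| ≤ (b - a) * δ := by
  rw [← intervalIntegral.integral_sub hf hp]
  have hb : ∀ x ∈ Ι a b, ‖f x - p x‖ ≤ δ := by
    intro x hx
    rw [Set.uIoc_of_le hab] at hx
    exact h x ⟨hx.1.le, hx.2⟩
  have := intervalIntegral.norm_integral_le_of_norm_le_const hb
  rw [Real.norm_eq_abs, abs_of_nonneg (sub_nonneg.2 hab)] at this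
  linarith

/-- Weighted form (used in Example 3): if `w ≥ 0` and `|f − p| ≤ δ` on `[a, b]`, then
`|∫_a^b w f − ∫_a^b w p| ≤ δ ∫_a^b w`. [cite: DavisRabinowitz1984, Sect. 2.5.8 (2.5.8.1)] -/
theorem abs_integral_weighted_sub_le_of_approx {a b δ : ℝ} (hab : a ≤ b) {w f p : ℝ → ℝ}
    (hw : ∀ x ∈ Set.Icc a b, 0 ≤ w x)
    (hwf : IntervalIntegrable (fun x => w x * f x) volume a b)
    (hwp : IntervalIntegrable (fun x => w x * p x) volume a b)
    (hwi : IntervalIntegrable w volume a b)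
    (h : ∀ x ∈ Set.Icc a b, |f x - p x| ≤ δ) :
    |(∫ x in a..b, w x * f x) - ∫ x in a..b, w x * p x| ≤ δ * ∫ x in a..b, w x := by
  rw [← intervalIntegral.integral_sub hwf hwp, ← intervalIntegral.integral_const_mul]
  have heq : (fun x => w x * f x - w x * p x) = fun x => w x * (f x - p x) := by
    funext x; ring
  rw [heq]
  have hwfp : IntervalIntegrable (fun x => w x * (f x - p x)) volume a b := by
    rw [← heq]; exact hwf.sub hwp
  have h1 : ∫ x in a..b, w x * (f x - p x) ≤ ∫ x in a..b, δ * w x := by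
    refine intervalIntegral.integral_mono_on hab hwfp (hwi.const_mul δ) fun x hx => ?_
    have := (abs_le.1 (h x hx)).2
    calc w x * (f x - p x) ≤ w x * δ := mul_le_mul_of_nonneg_left this (hw x hx)
      _ = δ * w x := mul_comm _ _
  have h2 : ∫ x in a..b, -(δ * w x) ≤ ∫ x in a..b, w x * (f x - p x) := by
    refine intervalIntegral.integral_mono_on hab (hwi.const_mul δ).neg hwfp fun x hx => ?_
    have := (abs_le.1 (h x hx)).1
    have := mul_le_mul_of_nonneg_left this (hw x hx)
    linarith [mul_comm (w x) δ]
  rw [intervalIntegral.integral_neg] at h2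
  exact abs_le.2 ⟨by linarith, h1⟩

/-! ## Example 3: `∫₀¹ x^{1/2} Γ(x+2) dx` from a cubic approximation of `Γ(x+2)` -/

/-- The cubic approximation of `Γ(x+2)` on `[0, 1]` quoted from Hart et al.:
`.99910836 + .4497361x + .2855737x² + .2646888x³`. [cite: DavisRabinowitz1984, Sect. 2.5.8 (2.5.8.1)] -/
noncomputable def gammaCubic (x : ℝ) : ℝ :=
  0.99910836 + 0.4497361 * x + 0.2855737 * x ^ 2 + 0.2646888 * x ^ 3

/-- The approximate value `(2/3)(.99910836) + (2/5)(.4497361) + (2/7)(.2855737) + (2/9)(.2646888)` of Example 3.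
[cite: DavisRabinowitz1984, Sect. 2.5.8 (2.5.8.1)] -/
noncomputable def example3Value : ℝ :=
  2/3 * 0.99910836 + 2/5 * 0.4497361 + 2/7 * 0.2855737 + 2/9 * 0.2646888

/-- The moments `∫₀¹ x^{1/2} xᵏ dx = 2/(2k+3)` (`2/3, 2/5, 2/7, 2/9` for `k = 0, …, 3`).
[cite: DavisRabinowitz1984, Sect. 2.5.8 (2.5.8.1)] -/
theorem integral_sqrt_mul_pow (k : ℕ) :
    ∫ x in (0:ℝ)..1, Real.sqrt x * x ^ k = 2 / (2 * k + 3) := by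
  have h : ∀ x ∈ Set.uIcc (0:ℝ) 1, Real.sqrt x * x ^ k = x ^ ((k:ℝ) + 1/2) := by
    intro x hx
    rw [Set.uIcc_of_le zero_le_one] at hx
    rw [Real.sqrt_eq_rpow, ← Real.rpow_natCast, ← Real.rpow_add' hx.1 (by positivity)]
    ring_nf
  have hk : (-1:ℝ) < (k:ℝ) + 1/2 := by have : (0:ℝ) ≤ k := Nat.cast_nonneg k; linarith
  rw [intervalIntegral.integral_congr h, integral_rpow (Or.inl hk)]
  simp only [Real.one_rpow]
  rw [Real.zero_rpow (by positivity)]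
  field_simp
  ring

/-- `∫₀¹ x^{1/2} · cubic = (2/3)a₀ + (2/5)a₁ + (2/7)a₂ + (2/9)a₃` = the approximate value of Example 3.
[cite: DavisRabinowitz1984, Sect. 2.5.8 (2.5.8.1)] -/
theorem integral_sqrt_mul_gammaCubic :
    ∫ x in (0:ℝ)..1, Real.sqrt x * gammaCubic x = example3Value := by
  have e : (fun x => Real.sqrt x * gammaCubic x) = fun x =>
      0.99910836 * (Real.sqrt x * x ^ 0) + 0.4497361 * (Real.sqrt x * x ^ 1)
        + 0.2855737 * (Real.sqrt x * x ^ 2) + 0.2646888 * (Real.sqrt x * x ^ 3) := by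
    funext x; unfold gammaCubic; ring
  have hi : ∀ k : ℕ, IntervalIntegrable (fun x => Real.sqrt x * x ^ k) volume (0:ℝ) 1 := fun k =>
    (Real.continuous_sqrt.mul (continuous_pow k)).intervalIntegrable _ _
  rw [e, intervalIntegral.integral_add, intervalIntegral.integral_add, intervalIntegral.integral_add,
    intervalIntegral.integral_const_mul, intervalIntegral.integral_const_mul,
    intervalIntegral.integral_const_mul, intervalIntegral.integral_const_mul,
    integral_sqrt_mul_pow, integral_sqrt_mul_pow, integral_sqrt_mul_pow, integral_sqrt_mul_pow]
  · unfold example3Value; norm_num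
  all_goals first
    | exact (hi _).const_mul _
    | exact ((hi _).const_mul _).add ((hi _).const_mul _)
    | exact (((hi _).const_mul _).add ((hi _).const_mul _)).add ((hi _).const_mul _)

/-- `I ≈ .986`: the approximate value (`= .98637…`) lies in `(.9863, .9864)`. [cite: DavisRabinowitz1984, Sect. 2.5.8 (2.5.8.1)] -/
theorem example3Value_bounds : 0.9863 < example3Value ∧ example3Value < 0.9864 := by
  unfold example3Value; constructor <;> norm_num

/-- **Example 3, error bound**: for ANY integrand `g` with `|g(x) − cubic(x)| ≤ .0009` on `[0, 1]` (the text's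
hypothesis on `Γ(x+2)`, not certified here), `|∫₀¹ x^{1/2} g(x) dx − I_approx| ≤ (2/3)(.0009) = .0006`.
[cite: DavisRabinowitz1984, Sect. 2.5.8 (2.5.8.1)] -/
theorem example3_error_bound {g : ℝ → ℝ} (hg : ContinuousOn g (Set.Icc 0 1))
    (happrox : ∀ x ∈ Set.Icc (0:ℝ) 1, |g x - gammaCubic x| ≤ 0.0009) :
    |(∫ x in (0:ℝ)..1, Real.sqrt x * g x) - example3Value| ≤ 0.0006 := by
  rw [← integral_sqrt_mul_gammaCubic]
  have hgc : Continuous gammaCubic := by unfold gammaCubic; fun_prop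
  have h := abs_integral_weighted_sub_le_of_approx zero_le_one (w := Real.sqrt) (f := g) (p := gammaCubic)
    (fun x _ => Real.sqrt_nonneg x)
    ((Real.continuous_sqrt.continuousOn.mul hg).intervalIntegrable_of_Icc zero_le_one)
    ((Real.continuous_sqrt.mul hgc).intervalIntegrable _ _)
    (Real.continuous_sqrt.intervalIntegrable _ _) happrox
  have hs : ∫ x in (0:ℝ)..1, Real.sqrt x = 2 / 3 := by
    have := integral_sqrt_mul_pow 0
    norm_num at this
    exact this
  rw [hs] at h
  linarith

end Literature.Analysis.Quadrature
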